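import Mathlib
import Literature.Computability.AlgebraicComplexity.BorderApolarityLimits
import Literature.Computability.AlgebraicComplexity.TensorApolarityForms
import Summits.MatrixMultiplication.MatrixMultiplication.Theorems.FidelityWitnessesFidelityGapThreeSeventeenStubFatBorderApolarityLimits
import Summits.MatrixMultiplication.MatrixMultiplication.Theorems.FidelityWitnessesFidelityGapThreeSeventeenStubFatBorderApolarityForms

/-!
# Fat border apolarity for `⟨3,3,3⟩` — support file C: perturbed points impose independent
# conditions (simple and double), hence `codim I_m = r` and `codim J_m ≥ k`

Crux `stmt-MatrixMultiplication-4958` (`FidelityWitnesses.FidelityGapThreeSeventeen`), line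
`symbolic-square-border-apolarity`, stub `stub_fatBorderApolarity` (helper file; general, reusable).

For a block-multigraded polynomial ring `K[x_σ]`, moving points `q_ρ(ε)` of an approximate
decomposition and a configuration `x_ρ ∈ K^σ`, the PERTURBED points `p_ρ = q_ρ + ε^M x_ρ` (`M` beyond
all degrees of `q`) see the configuration in their top `ε`-coefficients: a form `g` of weight `m` and
total degree `D = ∑ m` has `g(p_ρ) = ε^{DM} g(x_ρ) + (lower)`, and `∂_v g (p_ρ) = ε^{(D-1)M} ∂_v g(x_ρ) +
(lower)` (`natDegree_aeval_le_and_coeff`, `pderiv_mem`). By the top-coefficient certificate of file A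
the value (resp. jet) functionals at the moving points have `L`-rank at least the `K`-rank of the value
(resp. jet) functionals at `x` on `S_m`; with `finrank_limSub_eq` this gives

* `finrank_Ilim_add` — **`dim I_m + r = dim S_m`** as soon as the `r` points `x_ρ` impose independent
  conditions on `S_m` (CHL §2.3 (ii): "we may choose the curves such that `codim I_{ijk} = r`");
* `finrank_Jlim_add_le` — **`dim J_m + k ≤ dim S_m`** as soon as the `r` DOUBLE points `2x_ρ` impose
  `≥ k` independent conditions on `S_m` (the input of the symbolic-square tests).

References: A. Conner, A. Harper, J. M. Landsberg, Forum Math. Pi 11 (2023) e17 = arXiv:1911.07981,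
§2.3; W. Buczyńska, J. Buczyński, Duke Math. J. 170 (2021), Thm. 1.2.
-/

noncomputable section

namespace Summit.MatrixMultiplication.MatrixMultiplication.Theorems.SymbolicSquare.FatBorder

-- single-conjunct summit: the `Summit.<S>.<P>` prefix repeats `MatrixMultiplication` by design (D-0017)
set_option linter.dupNamespace false

open scoped BigOperators Polynomial
open Polynomial Module
open Literature.Computability.AlgebraicComplexity
open Literature.Computability.AlgebraicComplexity.TensorApolarity

universe u

variable {K : Type u} [Field K]

/-! ## The rank certificate, reindexed to arbitrary finite functional families -/

section Reindex

variable (L : Type u) [Field L] [Algebra K[X] L] [IsFractionRing K[X] L]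
variable {Λ n : Type} [Fintype Λ] [Fintype n]

/-- `dim_L vanGen + rank T ≤ |n|` whenever the `K`-linear symbol `T` computes top coefficients of
bounded row degrees (file A, reindexed). [folklore] -/
theorem finrank_vanGen_add_finrank_range_le (P : Λ → n → K[X]) (T : (n → K) →ₗ[K] (Λ → K))
    (Nd : Λ → ℕ) (h : ∀ (g : n → K) (ℓ : Λ), (∑ s, C (g s) * P ℓ s).natDegree ≤ Nd ℓ ∧
      (∑ s, C (g s) * P ℓ s).coeff (Nd ℓ) = T g ℓ) :
    finrank L (vanGen L P) + finrank K (LinearMap.range T) ≤ Fintype.card n := by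
  classical
  set e := Fintype.equivFin Λ
  set T' : (n → K) →ₗ[K] (Fin (Fintype.card Λ) → K) :=
    (LinearEquiv.funCongrLeft K K e.symm).toLinearMap ∘ₗ T with hT'
  have hrange : finrank K (LinearMap.range T') = finrank K (LinearMap.range T) := by
    rw [hT', LinearMap.range_comp]
    exact LinearEquiv.finrank_map_eq _ _
  rw [← hrange]
  exact finrank_vanishingL_add_finrank_range_le L (fun i => P (e.symm i)) T' (fun i => Nd (e.symm i))
    fun g i => h g (e.symm i)

end Reindex

/-! ## Perturbed points and top coefficients of values of forms -/

section Pert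

variable {σ : Type} {r : ℕ}

/-- Degree `≤ M` and `ε^M`-coefficient `x_ρ` of the coordinates of the PERTURBED moving points
`p_ρ = q_ρ + ε^M x_ρ` (`M` beyond the degrees of `q`). [cite: ConnerHarperLandsberg2023, §2.3] -/
theorem natDegree_pert_le {q : Fin r → σ → K[X]} {M : ℕ} (hq : ∀ ρ v, (q ρ v).natDegree < M)
    (x : Fin r → σ → K) (ρ : Fin r) (v : σ) :
    (q ρ v + X ^ M * C (x ρ v)).natDegree ≤ M ∧ (q ρ v + X ^ M * C (x ρ v)).coeff M = x ρ v := by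
  constructor
  · refine (natDegree_add_le _ _).trans (max_le (hq ρ v).le ?_)
    refine (natDegree_mul_le).trans ?_
    simp
  · rw [coeff_add, coeff_eq_zero_of_natDegree_lt (hq ρ v), coeff_X_pow_mul', if_pos le_rfl,
      Nat.sub_self, coeff_C_zero, zero_add]

end Pert

section TopCoeff

variable {σ ι : Type} [Fintype σ] [Fintype ι] (w : σ → ι → ℕ)

/-- **Top coefficient of the value of a form at a perturbed point**: for `g` of weight `m` (total
degree `D = ∑ m`) and coordinates `P v = (lower) + ε^M y v`, `g(P)` has degree `≤ DM` and
`ε^{DM}`-coefficient `g(y)`. [cite: ConnerHarperLandsberg2023, §2.3] -/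
theorem natDegree_aeval_le_and_coeff (hw : ∀ v, ∑ l, w v l = 1) {m : ι → ℕ} {g : MvPolynomial σ K}
    (hg : g ∈ MvPolynomial.weightedHomogeneousSubmodule K w m) {M : ℕ} {P : σ → K[X]} {y : σ → K}
    (hP : ∀ v, (P v).natDegree ≤ M ∧ (P v).coeff M = y v) :
    (MvPolynomial.aeval P g).natDegree ≤ (∑ l, m l) * M ∧
      (MvPolynomial.aeval P g).coeff ((∑ l, m l) * M) = MvPolynomial.eval y g := by
  classical
  set D := ∑ l, m l with hD
  have hmon : ∀ d ∈ g.support,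
      (C (MvPolynomial.coeff d g) * ∏ i, P i ^ d i).natDegree ≤ D * M ∧
      (C (MvPolynomial.coeff d g) * ∏ i, P i ^ d i).coeff (D * M) =
        MvPolynomial.coeff d g * ∏ i, y i ^ d i := by
    intro d hd
    have hwd : Finsupp.weight w d = m := hg (MvPolynomial.mem_support_iff.1 hd)
    have hdeg : ∑ i, d i * M = D * M := by
      rw [← Finset.sum_mul, ← Finsupp.degree_eq_sum, degree_eq_sum_weight w hw d, hwd]
    have hprod := natDegree_prod_le_and_coeff Finset.univ (fun i => P i ^ d i) (fun i => d i * M)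
      (fun i _ => natDegree_pow_le_of_le (d i) (hP i).1)
    rw [hdeg] at hprod
    have hc : ∀ i, (P i ^ d i).coeff (d i * M) = y i ^ d i := fun i => by
      rw [coeff_pow_of_natDegree_le (hP i).1, (hP i).2]
    simp only [hc] at hprod
    refine ⟨(natDegree_C_mul_le _ _).trans hprod.1, ?_⟩
    rw [coeff_C_mul, hprod.2]
  rw [MvPolynomial.aeval_def, MvPolynomial.eval₂_eq', Polynomial.algebraMap_eq]
  refine ⟨natDegree_sum_le_of_forall_le _ _ fun d hd => (hmon d hd).1, ?_⟩
  rw [finsetSum_coeff, MvPolynomial.eval_eq']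
  exact Finset.sum_congr rfl fun d hd => (hmon d hd).2

omit [Fintype σ] [Fintype ι] in
/-- First partials lower the weight: `∂_v S_m ⊆ S_{m - w v}`. [folklore] -/
theorem pderiv_mem {m : ι → ℕ} {g : MvPolynomial σ K}
    (hg : g ∈ MvPolynomial.weightedHomogeneousSubmodule K w m) (v : σ) :
    MvPolynomial.pderiv v g ∈ MvPolynomial.weightedHomogeneousSubmodule K w (m - w v) := by
  classical
  intro d hd
  rw [MvPolynomial.coeff_pderiv] at hd
  have h1 : MvPolynomial.coeff (d + Finsupp.single v 1) g ≠ 0 := fun h => hd (by rw [h, zero_mul])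
  have hwt : Finsupp.weight w (d + Finsupp.single v 1) = m := hg h1
  rw [map_add, Finsupp.weight_single, one_smul] at hwt
  rw [← hwt]
  funext l
  simp

end TopCoeff

/-! ## The value and jet symbols at the limit configuration -/

section Symbols

variable {σ ι : Type} [Fintype σ] [Fintype ι] (w : σ → ι → ℕ) (m : ι → ℕ) {r : ℕ}

omit [Fintype σ] [Fintype ι] in
/-- The joint kernel of the JET functionals at a configuration (`(ρ, none) ↦ g(x_ρ)`,
`(ρ, some v) ↦ ∂_v g(x_ρ)`) is the space of forms vanishing doubly at the points. [folklore] -/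
theorem iInf_ker_jet (x : Fin r → σ → K) :
    (⨅ ℓ : Fin r × Option σ, LinearMap.ker (ℓ.2.elim (MvPolynomial.aeval (x ℓ.1)).toLinearMap
      fun v => (MvPolynomial.aeval (x ℓ.1)).toLinearMap ∘ₗ (MvPolynomial.pderiv v).toLinearMap :
        MvPolynomial σ K →ₗ[K] K)) =
    ⨅ ρ, (LinearMap.ker (MvPolynomial.aeval (x ρ)).toLinearMap ⊓
      ⨅ v, LinearMap.ker ((MvPolynomial.aeval (x ρ)).toLinearMap ∘ₗ
        (MvPolynomial.pderiv v).toLinearMap)) := by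
  ext g
  simp only [Submodule.mem_iInf, Submodule.mem_inf]
  constructor
  · intro h ρ
    exact ⟨h (ρ, none), fun v => h (ρ, some v)⟩
  · rintro h ⟨ρ, _ | v⟩
    exacts [(h ρ).1, (h ρ).2 v]

/-- Rank–nullity for a family of functionals restricted to `S_m` (through `form`). [folklore] -/
theorem finrank_range_pi_add (hw : ∀ v, ∑ l, w v l = 1) {Λ : Type} [Fintype Λ]
    (φ : Λ → MvPolynomial σ K →ₗ[K] K) :
    finrank K (LinearMap.range (LinearMap.pi fun ℓ => φ ℓ ∘ₗ form w m K)) +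
      finrank K ↥(MvPolynomial.weightedHomogeneousSubmodule K w m ⊓ ⨅ ℓ, LinearMap.ker (φ ℓ)) =
      finrank K (MvPolynomial.weightedHomogeneousSubmodule K w m) := by
  have h := LinearMap.finrank_range_add_finrank_ker (LinearMap.pi fun ℓ => φ ℓ ∘ₗ form w m K)
  have hker : LinearMap.ker (LinearMap.pi fun ℓ => φ ℓ ∘ₗ form w m K) =
      Submodule.comap (form w m K) (⨅ ℓ, LinearMap.ker (φ ℓ)) := by
    rw [LinearMap.ker_pi, Submodule.comap_iInf]
    rfl
  have hmap : Submodule.map (form w m K) (Submodule.comap (form w m K) (⨅ ℓ, LinearMap.ker (φ ℓ))) =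
      MvPolynomial.weightedHomogeneousSubmodule K w m ⊓ ⨅ ℓ, LinearMap.ker (φ ℓ) := by
    rw [Submodule.map_comap_eq, range_form w m hw]
  have hk : finrank K ↥(LinearMap.ker (LinearMap.pi fun ℓ => φ ℓ ∘ₗ form w m K)) =
      finrank K ↥(MvPolynomial.weightedHomogeneousSubmodule K w m ⊓ ⨅ ℓ, LinearMap.ker (φ ℓ)) :=
    ((LinearEquiv.ofEq _ _ hker).trans
      ((Submodule.equivMapOfInjective _ (form_injective w m) _).trans
        (LinearEquiv.ofEq _ _ hmap))).finrank_eq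
  rw [hk, Module.finrank_fintype_fun_eq_card K,
    ← finrank_weightedHomogeneousSubmodule_eq_card (K := K) w m hw] at h
  exact h

variable {w m}

/-- `I_m` is finite-dimensional. [folklore] -/
theorem finite_Ilim (p : Fin r → σ → K[X]) : Module.Finite K (Ilim K w m p) := by
  unfold Ilim; infer_instance

/-- `J_m` is finite-dimensional. [folklore] -/
theorem finite_Jlim (p : Fin r → σ → K[X]) : Module.Finite K (Jlim K w m p) := by
  unfold Jlim; infer_instance

/-- `∑_s g_s · (value row) = g(p_ρ)` for a constant coefficient vector. [folklore] -/
theorem sum_C_mul_valMat (p : Fin r → σ → K[X]) (g : Mon w m → K) (ρ : Fin r) :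
    ∑ s, C (g s) * valMat w m p ρ s = MvPolynomial.aeval (p ρ) (form w m K g) := by
  rw [sum_mul_valMat, ← map_form, MvPolynomial.eval_map, MvPolynomial.aeval_def, Polynomial.algebraMap_eq]

/-- `∑_s g_s · (jet value row) = g(p_ρ)` for a constant coefficient vector. [folklore] -/
theorem sum_C_mul_jetMat_none (p : Fin r → σ → K[X]) (g : Mon w m → K) (ρ : Fin r) :
    ∑ s, C (g s) * jetMat w m p (ρ, none) s = MvPolynomial.aeval (p ρ) (form w m K g) := by
  rw [sum_mul_jetMat_none, ← map_form, MvPolynomial.eval_map, MvPolynomial.aeval_def,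
    Polynomial.algebraMap_eq]

/-- `∑_s g_s · (jet derivative row) = ∂_v g(p_ρ)` for a constant coefficient vector. [folklore] -/
theorem sum_C_mul_jetMat_some (p : Fin r → σ → K[X]) (g : Mon w m → K) (ρ : Fin r) (v : σ) :
    ∑ s, C (g s) * jetMat w m p (ρ, some v) s =
      MvPolynomial.aeval (p ρ) (MvPolynomial.pderiv v (form w m K g)) := by
  rw [sum_mul_jetMat_some, ← map_form, MvPolynomial.pderiv_map, MvPolynomial.eval_map,
    MvPolynomial.aeval_def, Polynomial.algebraMap_eq]

/-- **`dim I_m + r = dim S_m`** for the perturbed points `p = q + ε^M x` (`M` beyond the degrees of `q`)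
as soon as the `r` limit points `x_ρ` impose independent conditions on `S_m`.
[cite: ConnerHarperLandsberg2023, §2.3] -/
theorem finrank_Ilim_add (hw : ∀ v, ∑ l, w v l = 1) {q : Fin r → σ → K[X]} {x : Fin r → σ → K}
    {M : ℕ} (hq : ∀ ρ v, (q ρ v).natDegree < M)
    (hx : finrank K ↥(MvPolynomial.weightedHomogeneousSubmodule K w m ⊓
        ⨅ ρ, LinearMap.ker (MvPolynomial.aeval (x ρ)).toLinearMap) + r ≤
      finrank K (MvPolynomial.weightedHomogeneousSubmodule K w m)) :
    finrank K (Ilim K w m (fun ρ v => q ρ v + X ^ M * C (x ρ v))) + r =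
      finrank K (MvPolynomial.weightedHomogeneousSubmodule K w m) := by
  classical
  set p : Fin r → σ → K[X] := fun ρ v => q ρ v + X ^ M * C (x ρ v) with hp
  have hcard := finrank_weightedHomogeneousSubmodule_eq_card (K := K) w m hw
  have h1 := card_le_finrank_vanGen_add (FractionRing K[X]) (valMat w m p)
  rw [Fintype.card_fin] at h1
  have hP : ∀ ρ v, (p ρ v).natDegree ≤ M ∧ (p ρ v).coeff M = x ρ v :=
    fun ρ v => natDegree_pert_le hq x ρ v
  have hsym := finrank_range_pi_add w m hw (fun ρ => (MvPolynomial.aeval (x ρ)).toLinearMap)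
  have h2 := finrank_vanGen_add_finrank_range_le (FractionRing K[X]) (valMat w m p)
    (LinearMap.pi fun ρ => (MvPolynomial.aeval (x ρ)).toLinearMap ∘ₗ form w m K)
    (fun _ => (∑ l, m l) * M) fun g ρ => by
      rw [sum_C_mul_valMat]
      have := natDegree_aeval_le_and_coeff w hw (form_mem w m g) (hP ρ)
      simpa [MvPolynomial.coe_aeval_eq_eval] using this
  rw [finrank_Ilim]
  omega

/-- **`dim J_m + k ≤ dim S_m`** for the perturbed points as soon as the `r` limit DOUBLE points impose
at least `k` independent conditions on `S_m`. [folklore] -/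
theorem finrank_Jlim_add_le (hw : ∀ v, ∑ l, w v l = 1) {q : Fin r → σ → K[X]} {x : Fin r → σ → K}
    {M : ℕ} (hq : ∀ ρ v, (q ρ v).natDegree < M) {k : ℕ}
    (hx : finrank K ↥(MvPolynomial.weightedHomogeneousSubmodule K w m ⊓
        ⨅ ρ, (LinearMap.ker (MvPolynomial.aeval (x ρ)).toLinearMap ⊓
          ⨅ v, LinearMap.ker ((MvPolynomial.aeval (x ρ)).toLinearMap ∘ₗ
            (MvPolynomial.pderiv v).toLinearMap))) + k ≤
      finrank K (MvPolynomial.weightedHomogeneousSubmodule K w m)) :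
    finrank K (Jlim K w m (fun ρ v => q ρ v + X ^ M * C (x ρ v))) + k ≤
      finrank K (MvPolynomial.weightedHomogeneousSubmodule K w m) := by
  classical
  set p : Fin r → σ → K[X] := fun ρ v => q ρ v + X ^ M * C (x ρ v) with hp
  set φ : Fin r × Option σ → MvPolynomial σ K →ₗ[K] K := fun ℓ =>
    ℓ.2.elim (MvPolynomial.aeval (x ℓ.1)).toLinearMap
      fun v => (MvPolynomial.aeval (x ℓ.1)).toLinearMap ∘ₗ (MvPolynomial.pderiv v).toLinearMap with hφ
  have hP : ∀ ρ v, (p ρ v).natDegree ≤ M ∧ (p ρ v).coeff M = x ρ v :=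
    fun ρ v => natDegree_pert_le hq x ρ v
  have hcard := finrank_weightedHomogeneousSubmodule_eq_card (K := K) w m hw
  have hker : (⨅ ℓ, LinearMap.ker (φ ℓ)) = ⨅ ρ, (LinearMap.ker (MvPolynomial.aeval (x ρ)).toLinearMap ⊓
      ⨅ v, LinearMap.ker ((MvPolynomial.aeval (x ρ)).toLinearMap ∘ₗ
        (MvPolynomial.pderiv v).toLinearMap)) := by
    rw [hφ]; exact iInf_ker_jet x
  have hsym := finrank_range_pi_add w m hw φ
  rw [hker] at hsym
  have h2 := finrank_vanGen_add_finrank_range_le (FractionRing K[X]) (jetMat w m p)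
    (LinearMap.pi fun ℓ => φ ℓ ∘ₗ form w m K)
    (fun ℓ => match ℓ.2 with
      | none => (∑ l, m l) * M
      | some v => (∑ l, (m - w v) l) * M) ?_
  · rw [finrank_Jlim]
    omega
  · rintro g ⟨ρ, _ | v⟩
    · rw [sum_C_mul_jetMat_none]
      have := natDegree_aeval_le_and_coeff w hw (form_mem w m g) (hP ρ)
      simpa [hφ, MvPolynomial.coe_aeval_eq_eval] using this
    · rw [sum_C_mul_jetMat_some]
      have := natDegree_aeval_le_and_coeff w hw (pderiv_mem w (form_mem w m g) v) (hP ρ)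
      simpa [hφ, MvPolynomial.coe_aeval_eq_eval] using this

/-- **Registered sub-goal `stub_fatBorderApolarity_codim` of `stub_fatBorderApolarity`** (closed form of
`finrank_Ilim_add` over `ℂ`): `codim I_m = r` for the perturbed moving points.
[cite: ConnerHarperLandsberg2023, §2.3] -/
theorem stub_fatBorderApolarity_codim :
    ∀ (σ ι : Type) [Fintype σ] [Fintype ι] (w : σ → ι → ℕ) (m : ι → ℕ), (∀ v, ∑ l, w v l = 1) →
      ∀ (r M : ℕ) (q : Fin r → σ → Polynomial ℂ) (x : Fin r → σ → ℂ),
        (∀ ρ v, (q ρ v).natDegree < M) →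
        Module.finrank ℂ ↥(MvPolynomial.weightedHomogeneousSubmodule ℂ w m ⊓
            ⨅ ρ, LinearMap.ker (MvPolynomial.aeval (x ρ)).toLinearMap) + r ≤
          Module.finrank ℂ ↥(MvPolynomial.weightedHomogeneousSubmodule ℂ w m) →
        Module.finrank ℂ ↥(Ilim ℂ w m (fun ρ v => q ρ v + Polynomial.X ^ M * Polynomial.C (x ρ v))) + r =
          Module.finrank ℂ ↥(MvPolynomial.weightedHomogeneousSubmodule ℂ w m) :=
  fun _ _ _ _ _ _ hw _ _ _ _ hq hx => finrank_Ilim_add hw hq hx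

end Symbols

end Summit.MatrixMultiplication.MatrixMultiplication.Theorems.SymbolicSquare.FatBorder

end
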